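import Summits.ValiantsHypothesis.ValiantsHypothesis.Theorems.SymPencilPerFourInnerRankNineHyperplaneUniform
import Mathlib.Algebra.Module.Submodule.Union

/-!
# Route `SymPencil` — inner rank on hyperplanes, IV: good points on the section of the base
# family (IR9U programme; `--supports` stmt-ValiantsHypothesis-5674 `SdcSuperquadratic`; rung
# currency only — nothing here bears on `VP ≠ VNP`)

`SymPencilPerFourInnerRankNineHyperplaneUniform.family₂₃_U` leaves a third, DEGENERATE
alternative: the sextic `a₀ a₁ b₂ b₃ (a₂ b₃ + a₃ b₂) · (a₀ δ.2 1 + a₁ δ.2 0)` vanishes at every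
point `(a, b)` of the section `F₂₃ ∩ U'` (`F₂₃ = {b₀ = b₁ = 0}`).  This file kills that
alternative whenever each factor separately is non-zero SOMEWHERE on the section:

* `exists_good_point`: if the section contains points with `a₀ ≠ 0`, with `a₁ ≠ 0`, with
  `b₂ ≠ 0`, with `b₃ ≠ 0`, with `a₂ b₃ + a₃ b₂ ≠ 0`, and a pair `(δ, s)` with
  `s₀^a δ.2 1 + s₁^a δ.2 0 ≠ 0`, then ONE point of the section and one `δ ∈ U'` make the whole
  sextic non-zero (the five linear conditions by
  `Module.Dual.exists_forall_ne_zero_of_forall_exists`, the quadric along a line through a point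
  where it is non-zero: a non-zero polynomial in `t` has a non-root in an infinite field).

So the residual of blueprint §6 step (3) is reduced to the COORDINATE-TYPE sections (one of
`a₀, a₁, b₂, b₃` vanishing identically on `F₂₃ ∩ U'`), the quadric-degenerate sections (excluded
by rank, not here) and the derivative-degenerate ones (excluded by `finrank U' = 7`, not here).

Honest framing: a lemma of the IR9U programme (memo `HOME(val-lit)/NOTE-port4g2-CELL-NINE-SEVEN.md`
§6); IR9U/IR9H and the cell `(9,7,8)` stay OPEN/conditional; window `27 ≤ sdc(per₄) ≤ 29`
UNCHANGED; `VP ≠ VNP` not moved; no summit statement is proved here.  No definitions, no named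
facts. [folklore]
-/

noncomputable section

-- single-conjunct layout: Sub = Summit, duplicated namespace component intended
set_option linter.dupNamespace false

namespace Summit.ValiantsHypothesis.ValiantsHypothesis.Theorems.SymPencilPerFourInnerRankNineHyperplaneSection

open Matrix Finset Module Polynomial

variable {K : Type*} [Field K]

/-- **A good point on the section.**  See the module docstring. [folklore] -/
theorem exists_good_point [CharZero K] (U' : Submodule K ((Fin 4 → K) × (Fin 4 → K)))
    (h0 : ∃ u ∈ U', u.2 0 = 0 ∧ u.2 1 = 0 ∧ u.1 0 ≠ 0)
    (h1 : ∃ u ∈ U', u.2 0 = 0 ∧ u.2 1 = 0 ∧ u.1 1 ≠ 0)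
    (h2 : ∃ u ∈ U', u.2 0 = 0 ∧ u.2 1 = 0 ∧ u.2 2 ≠ 0)
    (h3 : ∃ u ∈ U', u.2 0 = 0 ∧ u.2 1 = 0 ∧ u.2 3 ≠ 0)
    (hq : ∃ u ∈ U', u.2 0 = 0 ∧ u.2 1 = 0 ∧ u.1 2 * u.2 3 + u.1 3 * u.2 2 ≠ 0)
    (hℓ : ∃ δ ∈ U', ∃ s ∈ U', s.2 0 = 0 ∧ s.2 1 = 0 ∧ s.1 0 * δ.2 1 + s.1 1 * δ.2 0 ≠ 0) :
    ∃ δ ∈ U', ∃ u ∈ U', u.2 0 = 0 ∧ u.2 1 = 0 ∧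
      u.1 0 * u.1 1 * u.2 2 * u.2 3 * (u.1 2 * u.2 3 + u.1 3 * u.2 2) *
        (u.1 0 * δ.2 1 + u.1 1 * δ.2 0) ≠ 0 := by
  classical
  obtain ⟨δ, hδ, s₀, hs₀, hs₀0, hs₀1, hs₀ℓ⟩ := hℓ
  -- the section `S = U' ∩ {b₀ = b₁ = 0}` as a submodule
  let S : Submodule K ((Fin 4 → K) × (Fin 4 → K)) :=
    U' ⊓ (LinearMap.ker ((LinearMap.proj 0 : (Fin 4 → K) →ₗ[K] K) ∘ₗ LinearMap.snd K _ _) ⊓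
      LinearMap.ker ((LinearMap.proj 1 : (Fin 4 → K) →ₗ[K] K) ∘ₗ LinearMap.snd K _ _))
  have hS : ∀ u, u ∈ S ↔ u ∈ U' ∧ u.2 0 = 0 ∧ u.2 1 = 0 := fun u => by
    simp only [S, Submodule.mem_inf, LinearMap.mem_ker, LinearMap.coe_comp, Function.comp_apply,
      LinearMap.snd_apply, LinearMap.proj_apply]
  -- the five linear conditions, as functionals on `S`
  let L : Fin 5 → Module.Dual K S := fun i =>
    match i with
    | 0 => ((LinearMap.proj 0 : (Fin 4 → K) →ₗ[K] K) ∘ₗ LinearMap.fst K _ _) ∘ₗ S.subtype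
    | 1 => ((LinearMap.proj 1 : (Fin 4 → K) →ₗ[K] K) ∘ₗ LinearMap.fst K _ _) ∘ₗ S.subtype
    | 2 => ((LinearMap.proj 2 : (Fin 4 → K) →ₗ[K] K) ∘ₗ LinearMap.snd K _ _) ∘ₗ S.subtype
    | 3 => ((LinearMap.proj 3 : (Fin 4 → K) →ₗ[K] K) ∘ₗ LinearMap.snd K _ _) ∘ₗ S.subtype
    | 4 => ((δ.2 1 • (LinearMap.proj 0 : (Fin 4 → K) →ₗ[K] K) +
              δ.2 0 • (LinearMap.proj 1 : (Fin 4 → K) →ₗ[K] K)) ∘ₗ LinearMap.fst K _ _) ∘ₗ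
            S.subtype
  have hL0 : ∀ x : S, L 0 x = (x : (Fin 4 → K) × (Fin 4 → K)).1 0 := fun x => rfl
  have hL1 : ∀ x : S, L 1 x = (x : (Fin 4 → K) × (Fin 4 → K)).1 1 := fun x => rfl
  have hL2 : ∀ x : S, L 2 x = (x : (Fin 4 → K) × (Fin 4 → K)).2 2 := fun x => rfl
  have hL3 : ∀ x : S, L 3 x = (x : (Fin 4 → K) × (Fin 4 → K)).2 3 := fun x => rfl
  have hL4 : ∀ x : S, L 4 x =
      δ.2 1 * (x : (Fin 4 → K) × (Fin 4 → K)).1 0 + δ.2 0 * (x : (Fin 4 → K) × (Fin 4 → K)).1 1 :=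
    fun x => rfl
  have hex : ∀ i, ∃ x : S, L i x ≠ 0 := by
    intro i
    match i with
    | 0 =>
      obtain ⟨u, hu, hu0, hu1, h⟩ := h0
      exact ⟨⟨u, (hS u).2 ⟨hu, hu0, hu1⟩⟩, by rw [hL0]; exact h⟩
    | 1 =>
      obtain ⟨u, hu, hu0, hu1, h⟩ := h1
      exact ⟨⟨u, (hS u).2 ⟨hu, hu0, hu1⟩⟩, by rw [hL1]; exact h⟩
    | 2 =>
      obtain ⟨u, hu, hu0, hu1, h⟩ := h2
      exact ⟨⟨u, (hS u).2 ⟨hu, hu0, hu1⟩⟩, by rw [hL2]; exact h⟩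
    | 3 =>
      obtain ⟨u, hu, hu0, hu1, h⟩ := h3
      exact ⟨⟨u, (hS u).2 ⟨hu, hu0, hu1⟩⟩, by rw [hL3]; exact h⟩
    | 4 =>
      refine ⟨⟨s₀, (hS s₀).2 ⟨hs₀, hs₀0, hs₀1⟩⟩, ?_⟩
      rw [hL4]
      intro h
      apply hs₀ℓ
      linear_combination h
  obtain ⟨x, hx⟩ := Module.Dual.exists_forall_ne_zero_of_forall_exists L hex
  -- a point where the quadric is non-zero, and the line through `x` towards it
  obtain ⟨uq, huq, huq0, huq1, hq0⟩ := hq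
  let y : S := ⟨uq, (hS uq).2 ⟨huq, huq0, huq1⟩⟩
  -- the sextic along the line `x + t y` is a non-zero polynomial in `t`
  let lin : Fin 5 → K[X] := fun i => Polynomial.C (L i x) + Polynomial.C (L i y) * Polynomial.X
  have hlin : ∀ i (t : K), (lin i).eval t = L i (x + t • y) := fun i t => by
    simp only [lin, map_add, map_smul, smul_eq_mul, Polynomial.eval_add, Polynomial.eval_mul,
      Polynomial.eval_C, Polynomial.eval_X]
    ring
  have hlin0 : ∀ i, lin i ≠ 0 := fun i h => by
    have := congrArg (Polynomial.eval 0) h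
    rw [hlin, zero_smul, add_zero, Polynomial.eval_zero] at this
    exact hx i this
  let Q : K[X] :=
    (Polynomial.C ((x : (Fin 4 → K) × (Fin 4 → K)).1 2) + Polynomial.C (uq.1 2) * Polynomial.X) *
      (Polynomial.C ((x : (Fin 4 → K) × (Fin 4 → K)).2 3) + Polynomial.C (uq.2 3) * Polynomial.X) +
    (Polynomial.C ((x : (Fin 4 → K) × (Fin 4 → K)).1 3) + Polynomial.C (uq.1 3) * Polynomial.X) *
      (Polynomial.C ((x : (Fin 4 → K) × (Fin 4 → K)).2 2) + Polynomial.C (uq.2 2) * Polynomial.X)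
  have hQ : ∀ t : K, Q.eval t =
      ((x : (Fin 4 → K) × (Fin 4 → K)) + t • uq).1 2 * ((x : (Fin 4 → K) × (Fin 4 → K)) + t • uq).2 3 +
        ((x : (Fin 4 → K) × (Fin 4 → K)) + t • uq).1 3 *
          ((x : (Fin 4 → K) × (Fin 4 → K)) + t • uq).2 2 := fun t => by
    simp only [Q, Prod.fst_add, Prod.snd_add, Prod.smul_fst, Prod.smul_snd, Pi.add_apply,
      Pi.smul_apply, smul_eq_mul, Polynomial.eval_add, Polynomial.eval_mul, Polynomial.eval_C,
      Polynomial.eval_X]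
    ring
  have hQ2 : Q.coeff 2 = uq.1 2 * uq.2 3 + uq.1 3 * uq.2 2 := by
    simp only [Q, Polynomial.coeff_add, Polynomial.coeff_mul_X, Polynomial.coeff_C_mul, mul_add,
      add_mul]
    simp [Polynomial.coeff_C, Polynomial.coeff_X, Polynomial.coeff_mul, Finset.Nat.antidiagonal_succ]
  have hQ0 : Q ≠ 0 := fun h => by
    have := congrArg (fun p : K[X] => p.coeff 2) h
    simp only [hQ2, Polynomial.coeff_zero] at this
    exact hq0 this
  set P : K[X] := lin 0 * lin 1 * lin 2 * lin 3 * Q * lin 4 with hP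
  have hP0 : P ≠ 0 :=
    mul_ne_zero (mul_ne_zero (mul_ne_zero (mul_ne_zero (mul_ne_zero (hlin0 0) (hlin0 1))
      (hlin0 2)) (hlin0 3)) hQ0) (hlin0 4)
  -- a non-root `t`
  obtain ⟨t, ht⟩ : ∃ t : K, ¬ P.IsRoot t := by
    by_contra hall
    push Not at hall
    exact hP0 (Polynomial.eq_zero_of_infinite_isRoot P (Set.infinite_univ.mono fun t _ => hall t))
  -- the point `x + t y`
  set u : (Fin 4 → K) × (Fin 4 → K) := (x : (Fin 4 → K) × (Fin 4 → K)) + t • uq with hu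
  have huS : u ∈ S := S.add_mem x.2 (S.smul_mem t y.2)
  obtain ⟨huU, hu0, hu1⟩ := (hS u).1 huS
  refine ⟨δ, hδ, u, huU, hu0, hu1, ?_⟩
  rw [Polynomial.IsRoot.def, hP] at ht
  simp only [Polynomial.eval_mul, hlin, hQ, hL0, hL1, hL2, hL3, hL4] at ht
  have hxy : ((x + t • y : S) : (Fin 4 → K) × (Fin 4 → K)) = u := by
    rw [hu]; rfl
  simp only [hxy] at ht
  intro h
  apply ht
  linear_combination h

end Summit.ValiantsHypothesis.ValiantsHypothesis.Theorems.SymPencilPerFourInnerRankNineHyperplaneSection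

end
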